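import Summits.QuantumFields.BalabanUV.T4Continuum.Support.SmallFieldDomains

/-!
# T⁴ programme, SUBSTRATE — `Support/SmallFieldDomainsNorms`: the INDEX-WEIGHTED MULTISCALE SUP NORM of
# [Balaban1985BackgroundPropagators] (3.41) p. 397 on a domain sequence, as a bound PREDICATE, and its algebra
# (v1.0.1: DOCSTRING-ONLY sign correction of the (3.41) quotation after XREAD F-ne9leaf01g12-1 + append-only §4 alias `WSupLePrint`)

Audit cell `pub-balaban`, SUBSTRATE cell seat p4 (focus «multiscale norms»); companion of `Support/SmallFieldDomains` (the
domain sequences `Ω`, the layers `layer Ω j = Ω_j ∖ Ω_{j+1}`, the point index `ptIndex`), same namespace.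

WHAT IS PRINTED (documentation of what the predicate reads; nothing printed is asserted).  T. Bałaban, *Propagators for
lattice gauge theories in a background field*, Commun. Math. Phys. **99** (1985) 389–434, p. 397 (held text
`paper:balaban1985-cmp99-background-propagators` p. 9): *"Besides the above norms we will use also weighted norms, connected
with the sequence of domains {Ω_j}. We define for an arbitrary real number α  |A|_{(α)} = sup_{0≦j≦k} sup_{b ∈ Ω_j∖Ω_{j+1}}
(L^jη)^{−α}|A(b)|. (3.41)  Thus the norm |A|_{(α)} can be defined as the smallest number C such, that |A(b)| ≦ C(L^jη)^{α} for
b ∈ Ω_j∖Ω_{j+1}, j = 0, 1, …, k. For α negative we can take Ω_j instead of Ω_j∖Ω_{j+1} above."* (v1.0.1: the exponent SIGNS are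
now quoted as printed — render `…p009-x2.png`, XREAD F-ne9leaf01g12-1; v1 had them flipped, the OCR layer carrying no sign.)
CONVENTION (v1.0.1, one sentence): the parameter `α` of `WSupLe s Ω α A C` (`(s j)^α·‖A x‖ ≤ C`) is the DECAY EXPONENT = MINUS the
printed index of (3.41) — `WSupLe … α` is print's «|A|_{(−α)} ≤ C»; the regularity classes (3.35)∕(3.37)–(3.38) and [B11] (9)–(10)
(printed indices −1, −2, −3, whence print's «for α negative … Ω_j») are `α = 1, 2, 3` HERE, and (3.47)'s gains «|G′λ|_{(2+γ)} ≦ B₀|λ|_{(γ)}»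
are `α = −(2+γ)` vs `α = −γ` HERE; the print-indexed alias `WSupLePrint s Ω α := WSupLe s Ω (−α)` (§4) states things in print's sign.  The regularity classes (3.35)/(3.37)–(3.38) and the conclusions of [Balaban1985Variational]
Thm 1 (9)–(10) are bounds of exactly this shape with `α = 1, 2, 3` (and a Hölder variant).

WHAT THIS FILE PROVIDES (all `[folklore]`; the SCALE `s j` — `L^jη` in the paper, `L^j` in fine units, `L^{j−k}` in unit-lattice
units — is a PARAMETER `s : ℕ → ℝ`, so every consumer keeps its own length convention; values in any seminormed group `E`,
e.g. `E = Fin d → 𝔤` for vector fields with the `max_μ` of (3.39) built into the sup norm of `Fin d → 𝔤`):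
 * §1 **`WSupLe s Ω α A C`** `:⇔ ∀ j x, x ∈ Ω_j ∖ Ω_{j+1} → (s j)^α · ‖A x‖ ≤ C` (`α : ℤ`, `zpow`) — the predicate «`|A|_{(α)} ≤ C`»;
   the pointwise reading `WSupLe.norm_le` (`‖A x‖ ≤ C · (s j)^{−α}`), the index reading `wSupLe_iff_ptIndex` (one inequality per
   point of `Ω₀`, weight at the point index — needs the `BigDomainSeq` layer calculus of part 1), `α = 0` = plain sup on `Ω₀`;
 * §2 ALGEBRA: monotone in `C`; `add` (`C₁ + C₂`), `neg`, `sub`, `smul` (`|c|·C`), `zero`; PRODUCTS with exponents adding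
   (`WSupLe.mul`: `‖A x‖ ≤ …^{−α}`, `‖B x‖ ≤ …^{−β}` ⇒ the pointwise product of real functions, or any bilinear pairing bounded by
   the product of norms (`WSupLe.of_norm_le_mul`), is `≤ C₁C₂ (s j)^{−(α+β)}`); EXPONENT MONOTONICITY in both regimes
   (`s j ≤ 1`: raising `α` weakens; `1 ≤ s j`: lowering `α` weakens); change of scale `s ↦ c·s` (`WSupLe.rescale`);
 * §3 LOCALITY: the predicate depends on `A` only on `Ω₀` (`WSupLe.congr`), restriction to a smaller nested sequence, and the
   trivial sequence (`Ω_j = T` for `j ≤ k`, `∅` above: one layer `j = k`) where it is the plain weighted sup `(s k)^α‖A‖_∞ ≤ C`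
   (`wSupLe_const_iff`) — the GLOBAL small-field case of `RegularBackgroundTower.RegularTransporters`' size letter.

HONEST FRAMING (T4-DAG p. 1).  Norm BOOKKEEPING on `ℤ^d`; no configuration, no estimate; the Hölder norms (3.40) and the covariant
derivatives of (3.39) are NOT typed here (they need a configuration and transporters — rows NE2/NE3's vocabulary).  NOT an estimate
of any NE row; spine 0/9 unchanged; NOT infinite volume, NOT a mass gap, NOT Clay.  HONEST DEPENDENCY: continuum YM on T⁴ ⇐ BetaPertH
∧ nine spine estimates (0/9 proved); BetaPertH ⇐ (D1) ∧ (D4) ∧ CAP+tail; G-an2-4 gates asym, D1 and NE2/3/4.  No `sorry`.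
-/

noncomputable section

namespace Summit.QuantumFields.BalabanUV.T4Continuum.SmallFieldDomains

open Literature.MathematicalPhysics.QuantumFieldTheory.Balaban1983to89.B14DomainGeom

variable {d : ℕ} {E : Type*} [SeminormedAddCommGroup E]

/-! ## §1 The weighted sup norm (3.41) as a bound predicate -/

/-- **«`|A|_{(α)} ≤ C`» — THE INDEX-WEIGHTED MULTISCALE SUP NORM OF (3.41) AS A PREDICATE**: at every point `x` of the layer
`Ω_j ∖ Ω_{j+1}` (every `j`), `(s j)^α · ‖A x‖ ≤ C`; `s j` is the length scale of level `j` (`L^jη`), a parameter.  Typed READING of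
[Balaban1985BackgroundPropagators] (3.41) p. 397; a bound shape, asserted of nothing. [folklore] -/
def WSupLe (s : ℕ → ℝ) (Ω : ℕ → Set (Pt d)) (α : ℤ) (A : Pt d → E) (C : ℝ) : Prop :=
  ∀ j x, x ∈ layer Ω j → s j ^ α * ‖A x‖ ≤ C

namespace WSupLe

variable {s : ℕ → ℝ} {Ω : ℕ → Set (Pt d)} {α β : ℤ} {A B : Pt d → E} {C C₁ C₂ : ℝ}

/-- The defining inequality at a point of a layer. [folklore] -/
theorem le (h : WSupLe s Ω α A C) {j : ℕ} {x : Pt d} (hx : x ∈ layer Ω j) : s j ^ α * ‖A x‖ ≤ C := h j x hx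

/-- **POINTWISE READING** (print, with ITS index `α′ = −α`: *"|A(b)| ≦ C(L^jη)^{α′} for b ∈ Ω_j∖Ω_{j+1}"*): for positive scales,
`‖A x‖ ≤ C · (s j)^{−α}` on the layer `j` (`α` = this file's decay exponent). [folklore] -/
theorem norm_le (h : WSupLe s Ω α A C) (hs : ∀ j, 0 < s j) {j : ℕ} {x : Pt d} (hx : x ∈ layer Ω j) :
    ‖A x‖ ≤ C * s j ^ (-α) := by
  have hsj : 0 < s j ^ α := zpow_pos (hs j) α
  have h1 := h j x hx
  rw [zpow_neg, ← div_eq_mul_inv, le_div_iff₀ hsj, mul_comm]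
  exact h1

/-- Conversely, the pointwise bounds give the predicate. [folklore] -/
theorem of_norm_le (hs : ∀ j, 0 < s j) (h : ∀ j x, x ∈ layer Ω j → ‖A x‖ ≤ C * s j ^ (-α)) : WSupLe s Ω α A C := by
  intro j x hx
  have hsj : 0 < s j ^ α := zpow_pos (hs j) α
  have h1 := h j x hx
  rw [zpow_neg, ← div_eq_mul_inv, le_div_iff₀ hsj, mul_comm] at h1
  exact h1

/-- The predicate is equivalent to the family of pointwise bounds (positive scales). [folklore] -/
theorem iff_norm_le (hs : ∀ j, 0 < s j) :
    WSupLe s Ω α A C ↔ ∀ j x, x ∈ layer Ω j → ‖A x‖ ≤ C * s j ^ (-α) :=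
  ⟨fun h _ _ hx => h.norm_le hs hx, of_norm_le hs⟩

/-- A bound of this shape forces `0 ≤ C` as soon as some layer is inhabited. [folklore] -/
theorem nonneg (h : WSupLe s Ω α A C) (hs : ∀ j, 0 < s j) {j : ℕ} {x : Pt d} (hx : x ∈ layer Ω j) : 0 ≤ C :=
  le_trans (mul_nonneg (zpow_pos (hs j) α).le (norm_nonneg _)) (h j x hx)

end WSupLe

section IndexReading
variable {L M₁ R k : ℕ} {Ω : ℕ → Set (Pt d)} {s : ℕ → ℝ} {α : ℤ} {A : Pt d → E} {C : ℝ}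

/-- **INDEX READING**: for a big-block domain sequence the layers are the level sets of the point index, so
`|A|_{(α)} ≤ C` is ONE inequality per point of `Ω₀`, with the weight taken at the point's index. [folklore] -/
theorem wSupLe_iff_ptIndex (hΩ : BigDomainSeq L M₁ R k Ω) :
    WSupLe s Ω α A C ↔ ∀ x, x ∈ Ω 0 → s (ptIndex k Ω x) ^ α * ‖A x‖ ≤ C := by
  constructor
  · intro h x hx
    exact h _ x (mem_layer_ptIndex hΩ hx)
  · intro h j x hx
    have h0 : x ∈ Ω 0 := mem_zero_of_mem_layer hΩ hx
    have hj : ptIndex k Ω x = j := (mem_layer_iff_ptIndex hΩ h0).mp hx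
    rw [← hj]
    exact h x h0

/-- Exponent `0`: the plain sup bound on `Ω₀` (for a big-block domain sequence). [folklore] -/
theorem wSupLe_zero_iff (hΩ : BigDomainSeq L M₁ R k Ω) :
    WSupLe s Ω 0 A C ↔ ∀ x, x ∈ Ω 0 → ‖A x‖ ≤ C := by
  rw [wSupLe_iff_ptIndex hΩ]
  simp only [zpow_zero, one_mul]

end IndexReading

/-! ## §2 Algebra of the weighted sup bounds -/

namespace WSupLe

variable {s : ℕ → ℝ} {Ω : ℕ → Set (Pt d)} {α β : ℤ} {A B : Pt d → E} {C C₁ C₂ : ℝ}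

/-- Monotone in the constant. [folklore] -/
theorem mono (h : WSupLe s Ω α A C₁) (hC : C₁ ≤ C₂) : WSupLe s Ω α A C₂ := fun j x hx => (h j x hx).trans hC

/-- The zero field: `|0|_{(α)} ≤ 0`. [folklore] -/
theorem zero (s : ℕ → ℝ) (Ω : ℕ → Set (Pt d)) (α : ℤ) : WSupLe s Ω α (0 : Pt d → E) 0 := fun j x _ => by simp

/-- SUM: `|A + B|_{(α)} ≤ C₁ + C₂` (positive scales). [folklore] -/
theorem add (hs : ∀ j, 0 < s j) (hA : WSupLe s Ω α A C₁) (hB : WSupLe s Ω α B C₂) : WSupLe s Ω α (A + B) (C₁ + C₂) := by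
  intro j x hx
  have hsj : 0 ≤ s j ^ α := (zpow_pos (hs j) α).le
  calc s j ^ α * ‖(A + B) x‖ ≤ s j ^ α * (‖A x‖ + ‖B x‖) :=
        mul_le_mul_of_nonneg_left (norm_add_le _ _) hsj
    _ = s j ^ α * ‖A x‖ + s j ^ α * ‖B x‖ := by ring
    _ ≤ C₁ + C₂ := add_le_add (hA j x hx) (hB j x hx)

/-- NEGATION leaves the bound unchanged. [folklore] -/
theorem neg (hA : WSupLe s Ω α A C) : WSupLe s Ω α (-A) C := fun j x hx => by
  simpa only [Pi.neg_apply, norm_neg] using hA j x hx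

/-- DIFFERENCE: `|A − B|_{(α)} ≤ C₁ + C₂` (positive scales). [folklore] -/
theorem sub (hs : ∀ j, 0 < s j) (hA : WSupLe s Ω α A C₁) (hB : WSupLe s Ω α B C₂) : WSupLe s Ω α (A - B) (C₁ + C₂) := by
  rw [sub_eq_add_neg]; exact hA.add hs hB.neg

/-- SCALAR MULTIPLE (real scalars on a normed space): `|c • A|_{(α)} ≤ |c|·C`. [folklore] -/
theorem smul {E' : Type*} [SeminormedAddCommGroup E'] [NormedSpace ℝ E'] {A : Pt d → E'} (hs : ∀ j, 0 < s j)
    (hA : WSupLe s Ω α A C) (c : ℝ) : WSupLe s Ω α (c • A) (|c| * C) := by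
  intro j x hx
  have hsj : 0 ≤ s j ^ α := (zpow_pos (hs j) α).le
  calc s j ^ α * ‖(c • A) x‖ = |c| * (s j ^ α * ‖A x‖) := by
        rw [Pi.smul_apply, norm_smul, Real.norm_eq_abs]; ring
    _ ≤ |c| * C := mul_le_mul_of_nonneg_left (hA j x hx) (abs_nonneg c)

/-- **PRODUCTS, EXPONENTS ADD**: if a pairing `P x` of `A x` and `B x` is bounded by the product of the norms, then
`|A|_{(α)} ≤ C₁`, `|B|_{(β)} ≤ C₂` give `|P|_{(α+β)} ≤ C₁C₂` (positive scales) — the shape behind `|A|·|∇A|`-type terms and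
the `(L^jη)^{−1}·(L^jη)^{−2} = (L^jη)^{−3}` bookkeeping. [folklore] -/
theorem of_norm_le_mul {F G : Type*} [SeminormedAddCommGroup F] [SeminormedAddCommGroup G] {A : Pt d → E} {B : Pt d → F}
    {P : Pt d → G} (hs : ∀ j, 0 < s j) (hA : WSupLe s Ω α A C₁) (hB : WSupLe s Ω β B C₂)
    (hP : ∀ x, ‖P x‖ ≤ ‖A x‖ * ‖B x‖) : WSupLe s Ω (α + β) P (C₁ * C₂) := by
  intro j x hx
  have hsa : 0 ≤ s j ^ α := (zpow_pos (hs j) α).le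
  have hsb : 0 ≤ s j ^ β := (zpow_pos (hs j) β).le
  have h1 := hA j x hx
  have h2 := hB j x hx
  have hC₁ : 0 ≤ C₁ := le_trans (mul_nonneg hsa (norm_nonneg _)) h1
  calc s j ^ (α + β) * ‖P x‖ ≤ s j ^ (α + β) * (‖A x‖ * ‖B x‖) :=
        mul_le_mul_of_nonneg_left (hP x) (zpow_pos (hs j) _).le
    _ = (s j ^ α * ‖A x‖) * (s j ^ β * ‖B x‖) := by rw [zpow_add₀ (hs j).ne']; ring
    _ ≤ C₁ * C₂ := mul_le_mul h1 h2 (mul_nonneg hsb (norm_nonneg _)) hC₁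

/-- The real-valued case: pointwise product of functions. [folklore] -/
theorem mul {a b : Pt d → ℝ} (hs : ∀ j, 0 < s j) (ha : WSupLe s Ω α a C₁) (hb : WSupLe s Ω β b C₂) :
    WSupLe s Ω (α + β) (a * b) (C₁ * C₂) :=
  of_norm_le_mul hs ha hb fun x => by rw [Pi.mul_apply, norm_mul]

/-- EXPONENT MONOTONICITY, small scales (`0 < s j ≤ 1`, e.g. `s j = L^jη = L^{j−k}`): RAISING `α` weakens the weight, so a bound
at exponent `α'` implies the bound at every `α ≥ α'`… precisely `α' ≤ α ⇒ (s j)^α ≤ (s j)^{α'}`, hence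
`WSupLe … α' A C → WSupLe … α A C`. [folklore] -/
theorem of_exponent_le (hs : ∀ j, 0 < s j) (hs1 : ∀ j, s j ≤ 1) (hα : β ≤ α) (h : WSupLe s Ω β A C) : WSupLe s Ω α A C := by
  intro j x hx
  have hw : s j ^ α ≤ s j ^ β := zpow_le_zpow_right_of_le_one₀ (hs j) (hs1 j) hα
  exact le_trans (mul_le_mul_of_nonneg_right hw (norm_nonneg _)) (h j x hx)

/-- EXPONENT MONOTONICITY, large scales (`1 ≤ s j`, e.g. fine units `s j = L^j`): LOWERING `α` weakens the weight:
`α ≤ β ⇒ WSupLe … β A C → WSupLe … α A C`. [folklore] -/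
theorem of_le_exponent (hs1 : ∀ j, 1 ≤ s j) (hα : α ≤ β) (h : WSupLe s Ω β A C) : WSupLe s Ω α A C := by
  intro j x hx
  have hw : s j ^ α ≤ s j ^ β := zpow_le_zpow_right₀ (hs1 j) hα
  exact le_trans (mul_le_mul_of_nonneg_right hw (norm_nonneg _)) (h j x hx)

/-- CHANGE OF SCALE: `s ↦ c·s` (`c > 0`, e.g. `η`) multiplies the constant by `c^α`:
`WSupLe s Ω α A C → WSupLe (c·s) Ω α A (c^α·C)`. [folklore] -/
theorem rescale (h : WSupLe s Ω α A C) {c : ℝ} (hc : 0 < c) : WSupLe (fun j => c * s j) Ω α A (c ^ α * C) := by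
  intro j x hx
  have hcα : 0 ≤ c ^ α := (zpow_pos hc α).le
  calc (c * s j) ^ α * ‖A x‖ = c ^ α * (s j ^ α * ‖A x‖) := by rw [mul_zpow]; ring
    _ ≤ c ^ α * C := mul_le_mul_of_nonneg_left (h j x hx) hcα

end WSupLe

/-! ## §3 Locality and the global (one-layer) case -/

namespace WSupLe

variable {s : ℕ → ℝ} {Ω Ω' : ℕ → Set (Pt d)} {α : ℤ} {A B : Pt d → E} {C : ℝ}

/-- The predicate sees `A` only on `Ω₀ ⊇` every layer: fields agreeing on `Ω₀` have the same bounds. [folklore] -/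
theorem congr (hΩ : ∀ j, Ω j ⊆ Ω 0) (h : WSupLe s Ω α A C) (hAB : ∀ x, x ∈ Ω 0 → A x = B x) : WSupLe s Ω α B C := by
  intro j x hx
  rw [← hAB x (hΩ j hx.1)]
  exact h j x hx

/-- Layerwise restriction: if every layer of `Ω'` lies in the same-index layer of `Ω`, bounds transfer from `Ω` to `Ω'`.
[folklore] -/
theorem restrict (hsub : ∀ j, layer Ω' j ⊆ layer Ω j) (h : WSupLe s Ω α A C) : WSupLe s Ω' α A C :=
  fun j x hx => h j x (hsub j hx)

end WSupLe

/-- The TRIVIAL (global small-field) domain sequence with `k` levels: `Ω_j = T` for `j ≤ k`, `∅` above. [folklore] -/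
def constSeq (k : ℕ) : ℕ → Set (Pt d) := fun j => if j ≤ k then Set.univ else ∅

/-- Its only non-empty layer is `j = k`, and that layer is everything. [folklore] -/
theorem layer_constSeq (k j : ℕ) : layer (constSeq (d := d) k) j = if j = k then Set.univ else ∅ := by
  ext x
  simp only [mem_layer, constSeq]
  by_cases hj : j = k
  · subst hj; simp
  · by_cases hjk : j ≤ k
    · have : j + 1 ≤ k := by omega
      simp [hjk, this, hj]
    · simp [hjk, hj]

/-- The trivial sequence is a big-block domain sequence (any `L, M₁, R`). [folklore] -/
theorem bigDomainSeq_constSeq (L M₁ R k : ℕ) : BigDomainSeq L M₁ R k (constSeq (d := d) k) where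
  anti j x hx := by
    simp only [constSeq] at hx ⊢
    by_cases h : j + 1 ≤ k
    · have : j ≤ k := by omega
      simp [this]
    · simp [h] at hx
  cubes j := by
    simp only [constSeq]
    split_ifs
    · exact isUnionOfCubes_univ _
    · exact isUnionOfCubes_empty _
  sep j x hx y _ := by
    simp only [constSeq] at hx ⊢
    by_cases h : j + 1 ≤ k
    · have : j ≤ k := by omega
      simp [this]
    · simp [h] at hx
  above j hj := by
    simp only [constSeq]
    rw [if_neg (by omega)]

/-- **GLOBAL CASE**: on the trivial sequence `|A|_{(α)} ≤ C` is the plain weighted sup bound `(s k)^α · ‖A x‖ ≤ C` at every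
point — the shape of the size letter of `RegularBackgroundTower.RegularTransporters` (one index `j = k`). [folklore] -/
theorem wSupLe_constSeq_iff (s : ℕ → ℝ) (k : ℕ) (α : ℤ) (A : Pt d → E) (C : ℝ) :
    WSupLe s (constSeq k) α A C ↔ ∀ x, s k ^ α * ‖A x‖ ≤ C := by
  constructor
  · intro h x
    exact h k x (by rw [layer_constSeq]; simp)
  · intro h j x hx
    rw [layer_constSeq] at hx
    by_cases hj : j = k
    · subst hj; exact h x
    · simp [hj] at hx


/-! ## §4 (v1.0.1) The print-indexed alias -/

/-- **PRINT-INDEXED ALIAS**: `WSupLePrint s Ω α A C := WSupLe s Ω (−α) A C` — «`|A|_{(α)} ≤ C`» with `α` the index AS PRINTED in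
[Balaban1985BackgroundPropagators] (3.41) (so the regularity classes are `α = −1, −2, −3` and (3.47)'s smoothing gain reads
`WSupLePrint … (2+γ)` from `WSupLePrint … γ`). [folklore] -/
def WSupLePrint (s : ℕ → ℝ) (Ω : ℕ → Set (Pt d)) (α : ℤ) (A : Pt d → E) (C : ℝ) : Prop := WSupLe s Ω (-α) A C

/-- The alias unfolded. [folklore] -/
theorem wSupLePrint_iff (s : ℕ → ℝ) (Ω : ℕ → Set (Pt d)) (α : ℤ) (A : Pt d → E) (C : ℝ) :
    WSupLePrint s Ω α A C ↔ WSupLe s Ω (-α) A C := Iff.rfl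

/-- The printed pointwise reading: `WSupLePrint s Ω α A C` iff `‖A x‖ ≤ C·(s j)^{α}` on every layer `j` (positive scales) — literally
*"|A(b)| ≦ C(L^jη)^{α} for b ∈ Ω_j∖Ω_{j+1}"*. [folklore] -/
theorem wSupLePrint_iff_norm_le {s : ℕ → ℝ} (hs : ∀ j, 0 < s j) (Ω : ℕ → Set (Pt d)) (α : ℤ) (A : Pt d → E) (C : ℝ) :
    WSupLePrint s Ω α A C ↔ ∀ j x, x ∈ layer Ω j → ‖A x‖ ≤ C * s j ^ α := by
  rw [wSupLePrint_iff, WSupLe.iff_norm_le hs]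
  simp only [neg_neg]

end Summit.QuantumFields.BalabanUV.T4Continuum.SmallFieldDomains
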